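import Summits.Ventures.LatticeQCDFlow.Exactness.Phi4MetropolisPolyObsDCT
import Summits.Ventures.LatticeQCDFlow.Exactness.Phi4MetropolisActionCSD
import HarnessLib

/-!
# The ENERGY floor of the local Metropolis arm for the ACTION ITSELF: `τ_int,sweep(S) ≥ (e²/4) Var(S)/V − ½`

HONEST FRAMING: exact (Metropolis-corrected) sampling algorithms for lattice gauge theory;
figures of merit are autocorrelation/cost numbers at stated couplings and volumes; no
continuum-physics claim.  (SCALAR calibration rung S0-A: not a gauge result.)

Venture `LatticeQCDFlow` (cell pub-lqcd), topic `Exactness`; FANOUT row 2 (`s0-phi4`, LOCAL arm —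
gen-13's leftover (α″), first half: "the action itself needs the degree-8 analogue of `QuadObs`").
NEW WORK of the cell, composing `Phi4MetropolisPolyObs` / `Phi4MetropolisPolyObsDCT` (the random-site
scan is a reversible Markov `L²(e^{−S})`-contraction on `PolyObs` for every even step density with
all moments), the CPS line bound `MetropolisLineEnergyBound.line_energy_carre_le` and gen-13's
lattice assembly `Phi4MetropolisActionCSD` (there for BOUNDED observables moving no more than the
action).  The one new estimate: the per-site energy integrand of an UNBOUNDED such observable is
integrable against `e^{−S}`, because `min(1, e^{−ΔS})(ΔS)² ρ ≤ 4e^{−2}(1 + e^{−ΔS}) ρ` (CPS) and the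
proposal-averaged weight `φ ↦ ∫ e^{−S(φ|φ_x:=t')} ρ(t' − φ_x) dt'` is integrable on `ℝ^Λ` (one
Fubini along the coordinate line).  Nothing is cited as a fact; Caracciolo–Pelissetto–Sokal 1994
named as in `Phi4MetropolisActionCSD`.

## What is proved (`Λ = Fin (n+1)`, coercive action, `ρ ≥ 0` measurable even density)

* (`Phi4MetropolisPolyObs.integrable_proposalWeight`: `φ ↦ ∫ e^{−S(φ|φ_x:=t')} ρ(t'−φ_x) dt'` is
  integrable;)
* `site_energy_inner_le`, `integrable_site_energy_integrand`, **`site_energy_carre_le_of_lipschitz`** —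
  for EVERY measurable `f` with `|f(φ|φ_x:=t') − f φ| ≤ |S(φ|φ_x:=t') − S φ|` (no boundedness):
  `∫ (∫ a_x (f' − f)² ρ) e^{−S} ≤ 8e^{−2} Z`; `integral_metroScan_sq_dev_le_energy_of_lipschitz`;
* **`metropolisScan_tauInt_sweep_ge_energy_poly`** — `λ > 0`, any `J`, even step density with all
  moments, `f ∈ PolyObs` moving no more than the action, `g = f − ⟨f⟩`: summable sweep-thinned
  series and `ρ_g(n+1) < 1` ⇒ `τ_int,sweep(f) ≥ (e²/4) ⟨(f − ⟨f⟩)²⟩/(n+1) − ½`;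
* **`metropolisScan_tauInt_sweep_ge_actionSelf`** — the instance `f = S`:
  `τ_int,sweep(S) ≥ (e²/4) Var(S)/(n+1) − ½`; `…_actionSelf_window` — the engine's window `U[−δ,δ]`.

Reading (no numerics implied): at least `(e²/4) c_S − ½` sweeps per independent value of the action
ITSELF, `c_S = Var(S)/V`, for every even step law with moments: `z_int,S ≥ α/ν`.  NOT CLAIMED: the
ordered sweep; `ρ_g < 1` / summability; any value of `c_S`; CPS's factor `f₊`.
-/

namespace Summit.Ventures.LatticeQCDFlow.Exactness

open Real MeasureTheory Filter Finset
open Summit.Ventures.LatticeQCDFlow.Scoring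

section ActionSelf

variable {n : ℕ}

/-- **The CPS majorant of the per-site energy integrand** (no boundedness): for measurable `f` with
`|f(φ|φ_x:=t') − f φ| ≤ |S(φ|φ_x:=t') − S φ|`,
`∫ a_x(φ,t') (f' − f)² ρ(t'−φ_x) dt' ≤ 4e^{−2} (1 + (∫ e^{−S(φ|φ_x:=t')} ρ(t'−φ_x) dt') / e^{−S(φ)})`. -/
theorem site_energy_inner_le {J : Fin (n + 1) → Fin (n + 1) → ℝ} {lam ε K : ℝ} (hε : 0 < ε)
    (hS : ∀ φ : Fin (n + 1) → ℝ, ε * ∑ w, φ w ^ 2 - K ≤ latticePhi4Action J lam φ)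
    {ρ : ℝ → ℝ} (hρ0 : ∀ u, 0 ≤ ρ u) (hρm : Measurable ρ) (hρi : Integrable ρ)
    (hρ1 : ∫ u, ρ u = 1) {f : (Fin (n + 1) → ℝ) → ℝ}
    (hfS : ∀ (φ : Fin (n + 1) → ℝ) (x : Fin (n + 1)) (t' : ℝ),
      |f (Function.update φ x t') - f φ|
        ≤ |latticePhi4Action J lam (Function.update φ x t') - latticePhi4Action J lam φ|)
    (x : Fin (n + 1)) (φ : Fin (n + 1) → ℝ) :
    ∫ t', metroAccept J lam x φ t' * (f (Function.update φ x t') - f φ) ^ 2 * ρ (t' - φ x)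
      ≤ 4 * Real.exp (-2) * (1 + (∫ t', gibbsWeight J lam (Function.update φ x t') * ρ (t' - φ x))
          / gibbsWeight J lam φ) := by
  have hwφ := gibbsWeight_pos J lam φ
  have hρt : Integrable (fun t' => ρ (t' - φ x)) := hρi.comp_sub_right (φ x)
  have hw : Measurable (gibbsWeight J lam) := (continuous_gibbsWeight J lam).measurable
  have hWt : Integrable (fun t' => gibbsWeight J lam (Function.update φ x t') * ρ (t' - φ x)) := by
    refine Integrable.mono' (hρt.const_mul (Real.exp K))
      ((hw.comp (measurable_update φ)).mul (hρm.comp (measurable_id.sub measurable_const))).aestronglyMeasurable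
      (Eventually.of_forall fun t' => ?_)
    rw [Real.norm_eq_abs, abs_mul, abs_of_pos (gibbsWeight_pos J lam _), abs_of_nonneg (hρ0 _)]
    exact mul_le_mul_of_nonneg_right (gibbsWeight_le_exp hε hS _) (hρ0 _)
  have hR : Integrable (fun t' => 4 * Real.exp (-2) * (ρ (t' - φ x)
      + gibbsWeight J lam (Function.update φ x t') * ρ (t' - φ x) / gibbsWeight J lam φ)) :=
    (hρt.add (hWt.div_const _)).const_mul _
  have hmono : ∫ t', metroAccept J lam x φ t' * (f (Function.update φ x t') - f φ) ^ 2 * ρ (t' - φ x)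
      ≤ ∫ t', 4 * Real.exp (-2) * (ρ (t' - φ x)
          + gibbsWeight J lam (Function.update φ x t') * ρ (t' - φ x) / gibbsWeight J lam φ) := by
    refine integral_mono_of_nonneg (Eventually.of_forall fun t' => ?_) hR (Eventually.of_forall fun t' => ?_)
    · exact mul_nonneg (mul_nonneg (metroAccept_nonneg_le J lam x φ t').1 (sq_nonneg _)) (hρ0 _)
    · set Δ := latticePhi4Action J lam (Function.update φ x t') - latticePhi4Action J lam φ with hΔ
      have ha : metroAccept J lam x φ t' = min 1 (Real.exp (-Δ)) := by
        rw [metroAccept_eq_exp]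
      have hratio : gibbsWeight J lam (Function.update φ x t') / gibbsWeight J lam φ = Real.exp (-Δ) := by
        unfold gibbsWeight
        rw [← Real.exp_sub, hΔ]
        congr 1
        ring
      have hf2 : (f (Function.update φ x t') - f φ) ^ 2 ≤ Δ ^ 2 := by
        rw [← sq_abs, ← sq_abs Δ]
        exact pow_le_pow_left₀ (abs_nonneg _) (hfS φ x t') 2
      have ha0 : 0 ≤ min 1 (Real.exp (-Δ)) := le_min zero_le_one (Real.exp_pos _).le
      have hcps := accept_mul_sq_le Δ
      dsimp only
      rw [ha, mul_comm (gibbsWeight J lam (Function.update φ x t')) (ρ (t' - φ x)), mul_div_assoc,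
        hratio]
      calc min 1 (Real.exp (-Δ)) * (f (Function.update φ x t') - f φ) ^ 2 * ρ (t' - φ x)
          ≤ min 1 (Real.exp (-Δ)) * Δ ^ 2 * ρ (t' - φ x) :=
            mul_le_mul_of_nonneg_right (mul_le_mul_of_nonneg_left hf2 ha0) (hρ0 _)
        _ ≤ 4 * Real.exp (-2) * (1 + Real.exp (-Δ)) * ρ (t' - φ x) :=
            mul_le_mul_of_nonneg_right hcps (hρ0 _)
        _ = 4 * Real.exp (-2) * (ρ (t' - φ x) + ρ (t' - φ x) * Real.exp (-Δ)) := by ring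
  rw [integral_const_mul, integral_add hρt (hWt.div_const _), integral_sub_right_eq_self
    (μ := (volume : Measure ℝ)) ρ (φ x), hρ1, integral_div] at hmono
  exact hmono

/-- **The per-site energy integrand of an unbounded action-Lipschitz observable is integrable against
`e^{−S}`** (majorant `4e^{−2}(e^{−S} + ∫ e^{−S(φ|φ_x:=t')} ρ)`). -/
theorem integrable_site_energy_integrand {J : Fin (n + 1) → Fin (n + 1) → ℝ} {lam ε K : ℝ}
    (hε : 0 < ε) (hS : ∀ φ : Fin (n + 1) → ℝ, ε * ∑ w, φ w ^ 2 - K ≤ latticePhi4Action J lam φ)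
    {ρ : ℝ → ℝ} (hρ0 : ∀ u, 0 ≤ ρ u) (hρm : Measurable ρ) (hρi : Integrable ρ)
    (hρ1 : ∫ u, ρ u = 1) (hρs : ∀ u, ρ (-u) = ρ u) {f : (Fin (n + 1) → ℝ) → ℝ} (hfm : Measurable f)
    (hfS : ∀ (φ : Fin (n + 1) → ℝ) (x : Fin (n + 1)) (t' : ℝ),
      |f (Function.update φ x t') - f φ|
        ≤ |latticePhi4Action J lam (Function.update φ x t') - latticePhi4Action J lam φ|)
    (x : Fin (n + 1)) :
    Integrable (fun φ => (∫ t', metroAccept J lam x φ t' * (f (Function.update φ x t') - f φ) ^ 2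
        * ρ (t' - φ x)) * gibbsWeight J lam φ) := by
  have hw_int : Integrable (gibbsWeight J lam) := integrable_gibbsWeight_of_coercive hε hS
  have hw : Measurable (gibbsWeight J lam) := (continuous_gibbsWeight J lam).measurable
  have hupd : Measurable fun p : (Fin (n + 1) → ℝ) × ℝ => Function.update p.1 x p.2 :=
    measurable_update'
  have ha : Measurable fun p : (Fin (n + 1) → ℝ) × ℝ => metroAccept J lam x p.1 p.2 := by
    unfold metroAccept
    exact measurable_const.min ((hw.comp hupd).div (hw.comp measurable_fst))
  have hF : Measurable fun p : (Fin (n + 1) → ℝ) × ℝ =>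
      metroAccept J lam x p.1 p.2 * (f (Function.update p.1 x p.2) - f p.1) ^ 2 * ρ (p.2 - p.1 x) :=
    (ha.mul (((hfm.comp hupd).sub (hfm.comp measurable_fst)).pow_const 2)).mul
      (hρm.comp (measurable_snd.sub ((measurable_pi_apply x).comp measurable_fst)))
  have hinner_m : Measurable fun φ : Fin (n + 1) → ℝ =>
      ∫ t', metroAccept J lam x φ t' * (f (Function.update φ x t') - f φ) ^ 2 * ρ (t' - φ x) :=
    hF.stronglyMeasurable.integral_prod_right'.measurable
  have hG := integrable_proposalWeight hε hS hρ0 hρm hρi hρ1 hρs x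
  have hmaj : Integrable (fun φ : Fin (n + 1) → ℝ => 4 * Real.exp (-2) * (gibbsWeight J lam φ
      + ∫ t', gibbsWeight J lam (Function.update φ x t') * ρ (t' - φ x))) :=
    (hw_int.add hG).const_mul _
  refine Integrable.mono' hmaj (hinner_m.mul hw).aestronglyMeasurable (Eventually.of_forall fun φ => ?_)
  have hwφ := gibbsWeight_pos J lam φ
  have hin0 : 0 ≤ ∫ t', metroAccept J lam x φ t' * (f (Function.update φ x t') - f φ) ^ 2 * ρ (t' - φ x) :=
    integral_nonneg fun t' => mul_nonneg (mul_nonneg (metroAccept_nonneg_le J lam x φ t').1 (sq_nonneg _)) (hρ0 _)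
  rw [Real.norm_eq_abs, abs_of_nonneg (mul_nonneg hin0 hwφ.le)]
  have h := mul_le_mul_of_nonneg_right (site_energy_inner_le hε hS hρ0 hρm hρi hρ1 hfS x φ) hwφ.le
  calc _ ≤ 4 * Real.exp (-2) * (1 + (∫ t', gibbsWeight J lam (Function.update φ x t') * ρ (t' - φ x))
          / gibbsWeight J lam φ) * gibbsWeight J lam φ := h
    _ = 4 * Real.exp (-2) * (gibbsWeight J lam φ
          + ∫ t', gibbsWeight J lam (Function.update φ x t') * ρ (t' - φ x)) := by
        field_simp

/-- **The per-site energy bound without boundedness**: coercive action, even step density `ρ`,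
measurable `f` with `|f(φ|φ_x:=t') − f(φ)| ≤ |S(φ|φ_x:=t') − S(φ)|`.  For every site `x`:
`∫ (∫ min(1, e^{−ΔS}) (f' − f)² ρ(t' − φ_x) dt') e^{−S(φ)} dφ ≤ 8 e^{−2} ∫ e^{−S}`. -/
theorem site_energy_carre_le_of_lipschitz {J : Fin (n + 1) → Fin (n + 1) → ℝ} {lam ε K : ℝ}
    (hε : 0 < ε) (hS : ∀ φ : Fin (n + 1) → ℝ, ε * ∑ w, φ w ^ 2 - K ≤ latticePhi4Action J lam φ)
    {ρ : ℝ → ℝ} (hρ0 : ∀ u, 0 ≤ ρ u) (hρm : Measurable ρ) (hρi : Integrable ρ)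
    (hρ1 : ∫ u, ρ u = 1) (hρs : ∀ u, ρ (-u) = ρ u) {f : (Fin (n + 1) → ℝ) → ℝ} (hfm : Measurable f)
    (hfS : ∀ (φ : Fin (n + 1) → ℝ) (x : Fin (n + 1)) (t' : ℝ),
      |f (Function.update φ x t') - f φ|
        ≤ |latticePhi4Action J lam (Function.update φ x t') - latticePhi4Action J lam φ|)
    (x : Fin (n + 1)) :
    ∫ φ, (∫ t', metroAccept J lam x φ t' * (f (Function.update φ x t') - f φ) ^ 2 * ρ (t' - φ x))
        * gibbsWeight J lam φ
      ≤ 8 * Real.exp (-2) * ∫ φ, gibbsWeight J lam φ := by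
  have hw_int : Integrable (gibbsWeight J lam) := integrable_gibbsWeight_of_coercive hε hS
  have hG := integrable_site_energy_integrand hε hS hρ0 hρm hρi hρ1 hρs hfm hfS x
  rw [integral_eq_integral_insertNth x hG, integral_eq_integral_insertNth x hw_int,
    ← integral_const_mul]
  refine integral_mono_of_nonneg (Eventually.of_forall fun x' => ?_)
    ((integrable_lineIntegral x hw_int).const_mul _) (Eventually.of_forall fun x' => ?_)
  · exact integral_nonneg fun t => mul_nonneg (integral_nonneg fun t' =>
      mul_nonneg (mul_nonneg (metroAccept_nonneg_le J lam x _ t').1 (sq_nonneg _)) (hρ0 _))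
      (gibbsWeight_pos J lam _).le
  · set ψ : Fin (n + 1) → ℝ := Fin.insertNth x (0 : ℝ) x' with hψ
    have hψx : ψ x = 0 := by simp [hψ]
    have hins : ∀ t : ℝ, (Fin.insertNth x t x' : Fin (n + 1) → ℝ) = Function.update ψ x t :=
      fun t => insertNth_eq_update x t x'
    simp only [hins]
    set Sl : ℝ → ℝ := fun t => latticePhi4Action J lam (Function.update ψ x t) with hSl
    set fl : ℝ → ℝ := fun t => f (Function.update ψ x t) with hfl
    have hSlm : Measurable Sl := (continuous_latticePhi4Action J lam).measurable.comp
      (measurable_update' (a := x) |>.comp (measurable_const.prodMk measurable_id))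
    have hwl : Integrable (fun t => Real.exp (-Sl t)) := integrable_gibbsWeight_line hε hS ψ x hψx
    have hflS : ∀ t t', |fl t' - fl t| ≤ |Sl t' - Sl t| := by
      intro t t'
      have h := hfS (Function.update ψ x t) x t'
      simp only [Function.update_idem] at h
      exact h
    have key := line_energy_carre_le hSlm hwl hρ0 hρm hρi hρ1 hρs hflS
    have hK : ∀ t, (∫ t', metroAccept J lam x (Function.update ψ x t) t'
        * (f (Function.update (Function.update ψ x t) x t') - f (Function.update ψ x t)) ^ 2
        * ρ (t' - Function.update ψ x t x)) * gibbsWeight J lam (Function.update ψ x t)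
        = (∫ t', min 1 (Real.exp (-Sl t') / Real.exp (-Sl t)) * (fl t' - fl t) ^ 2 * ρ (t' - t))
          * Real.exp (-Sl t) := by
      intro t
      unfold metroAccept gibbsWeight
      simp only [Function.update_idem, Function.update_self, hSl, hfl]
    simp only [hK]
    exact key

/-- **Averaged energy move bound for the scan, unbounded observables**:
`∫ K[(f − f φ)²](φ) e^{−S} dφ ≤ 8 e^{−2} Z` for measurable `f` moving no more than the action. -/
theorem integral_metroScan_sq_dev_le_energy_of_lipschitz {J : Fin (n + 1) → Fin (n + 1) → ℝ}
    {lam ε K : ℝ} (hε : 0 < ε)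
    (hS : ∀ φ : Fin (n + 1) → ℝ, ε * ∑ w, φ w ^ 2 - K ≤ latticePhi4Action J lam φ)
    {ρ : ℝ → ℝ} (hρ0 : ∀ u, 0 ≤ ρ u) (hρm : Measurable ρ) (hρi : Integrable ρ)
    (hρ1 : ∫ u, ρ u = 1) (hρs : ∀ u, ρ (-u) = ρ u) {f : (Fin (n + 1) → ℝ) → ℝ} (hfm : Measurable f)
    (hfS : ∀ (φ : Fin (n + 1) → ℝ) (x : Fin (n + 1)) (t' : ℝ),
      |f (Function.update φ x t') - f φ|
        ≤ |latticePhi4Action J lam (Function.update φ x t') - latticePhi4Action J lam φ|) :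
    ∫ φ, metroScan J lam ρ (fun ψ => (f ψ - f φ) ^ 2) φ * gibbsWeight J lam φ
      ≤ 8 * Real.exp (-2) * ∫ φ, gibbsWeight J lam φ := by
  have hn : (0 : ℝ) < (n : ℝ) + 1 := by positivity
  have hsite := fun x => site_energy_carre_le_of_lipschitz hε hS hρ0 hρm hρi hρ1 hρs hfm hfS x
  have e : ∀ φ, metroScan J lam ρ (fun ψ => (f ψ - f φ) ^ 2) φ * gibbsWeight J lam φ
      = (∑ x, (∫ t', metroAccept J lam x φ t' * (f (Function.update φ x t') - f φ) ^ 2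
          * ρ (t' - φ x)) * gibbsWeight J lam φ) / ((n : ℝ) + 1) := by
    intro φ
    unfold metroScan metroSite
    simp only [sub_self, zero_pow (two_ne_zero), mul_zero, add_zero]
    rw [div_mul_eq_mul_div, Finset.sum_mul]
  simp_rw [e]
  have hint := fun x => integrable_site_energy_integrand hε hS hρ0 hρm hρi hρ1 hρs hfm hfS x
  rw [integral_div, integral_finsetSum _ fun x _ => hint x, div_le_iff₀ hn]
  calc ∑ x, ∫ φ, (∫ t', metroAccept J lam x φ t' * (f (Function.update φ x t') - f φ) ^ 2
          * ρ (t' - φ x)) * gibbsWeight J lam φ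
      ≤ ∑ _x : Fin (n + 1), 8 * Real.exp (-2) * ∫ φ, gibbsWeight J lam φ :=
        Finset.sum_le_sum fun x _ => hsite x
    _ = 8 * Real.exp (-2) * (∫ φ, gibbsWeight J lam φ) * ((n : ℝ) + 1) := by
        rw [Finset.sum_const, Finset.card_univ, Fintype.card_fin, nsmul_eq_mul]
        push_cast
        ring

/-- **THE ENERGY FLOOR OF THE RANDOM-SCAN LOCAL METROPOLIS ARM ON `PolyObs` (no clip).**  Lattice φ⁴,
every `λ > 0`, every real `J`; `ρ ≥ 0` measurable even density with all moments; `f ∈ PolyObs` with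
`|f(φ|φ_x:=t') − f(φ)| ≤ |S(φ|φ_x:=t') − S(φ)|`, `g = f − ⟨f⟩`, one sweep = `n+1` site updates.
Summable sweep-thinned series and `ρ_g(n+1) < 1` ⇒ `τ_int,sweep(f) ≥ (e²/4) ⟨(f − ⟨f⟩)²⟩/(n+1) − ½`. -/
theorem metropolisScan_tauInt_sweep_ge_energy_poly {lam : ℝ} (hlam : 0 < lam)
    (J : Fin (n + 1) → Fin (n + 1) → ℝ) {ρ : ℝ → ℝ} (hρ0 : ∀ u, 0 ≤ ρ u) (hρm : Measurable ρ)
    (hρi : Integrable ρ) (hρ1 : ∫ u, ρ u = 1) (hρs : ∀ u, ρ (-u) = ρ u)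
    (hρmom : ∀ j : ℕ, Integrable (fun u => (1 + |u|) ^ j * ρ u))
    {f : (Fin (n + 1) → ℝ) → ℝ} (hf : PolyObs f)
    (hfS : ∀ (φ : Fin (n + 1) → ℝ) (x : Fin (n + 1)) (t' : ℝ),
      |f (Function.update φ x t') - f φ|
        ≤ |latticePhi4Action J lam (Function.update φ x t') - latticePhi4Action J lam φ|)
    (hs : Summable fun k => (∫ φ, (f φ - gibbsExpect J lam f)
        * ((metroScan J lam ρ)^[(n + 1) * (k + 1)] (fun ψ => f ψ - gibbsExpect J lam f)) φ
        * gibbsWeight J lam φ) / ∫ φ, (f φ - gibbsExpect J lam f) ^ 2 * gibbsWeight J lam φ)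
    (hρV : (∫ φ, (f φ - gibbsExpect J lam f)
        * ((metroScan J lam ρ)^[n + 1] (fun ψ => f ψ - gibbsExpect J lam f)) φ * gibbsWeight J lam φ)
        / (∫ φ, (f φ - gibbsExpect J lam f) ^ 2 * gibbsWeight J lam φ) < 1) :
    Real.exp 2 / 4 * gibbsExpect J lam (fun φ => (f φ - gibbsExpect J lam f) ^ 2) / (n + 1) - 1 / 2
      ≤ tauInt (fun k => (∫ φ, (f φ - gibbsExpect J lam f)
          * ((metroScan J lam ρ)^[(n + 1) * k] (fun ψ => f ψ - gibbsExpect J lam f)) φ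
          * gibbsWeight J lam φ) / ∫ φ, (f φ - gibbsExpect J lam f) ^ 2 * gibbsWeight J lam φ) := by
  have hco := latticePhi4Action_coercive hlam J
  have hg : PolyObs (fun ψ => f ψ - gibbsExpect J lam f) := by
    obtain ⟨hfm, B, k, hfb⟩ := hf
    refine ⟨hfm.sub measurable_const, |B| + |gibbsExpect J lam f|, k, fun φ => ?_⟩
    have e1 : 1 ≤ (1 + ∑ w, φ w ^ 2) ^ k := one_le_pow₀ (one_le_env φ)
    calc |f φ - gibbsExpect J lam f| ≤ |f φ| + |gibbsExpect J lam f| := abs_sub _ _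
      _ ≤ |B| * (1 + ∑ w, φ w ^ 2) ^ k + |gibbsExpect J lam f| * (1 + ∑ w, φ w ^ 2) ^ k :=
          add_le_add (abs_le_abs_mul_env hfb φ) (le_mul_of_one_le_right (abs_nonneg _) e1)
      _ = (|B| + |gibbsExpect J lam f|) * (1 + ∑ w, φ w ^ 2) ^ k := by ring
  have hgS : ∀ (φ : Fin (n + 1) → ℝ) (x : Fin (n + 1)) (t' : ℝ),
      |(f (Function.update φ x t') - gibbsExpect J lam f) - (f φ - gibbsExpect J lam f)|
        ≤ |latticePhi4Action J lam (Function.update φ x t') - latticePhi4Action J lam φ| := by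
    intro φ x t'
    rw [show (f (Function.update φ x t') - gibbsExpect J lam f) - (f φ - gibbsExpect J lam f)
      = f (Function.update φ x t') - f φ by ring]
    exact hfS φ x t'
  have hΓ := integral_metroScan_sq_dev_le_energy_of_lipschitz one_pos hco hρ0 hρm hρi hρ1 hρs hg.1 hgS
  have hfloor := RevOp.thinned_tauInt_ge_of_integral_carre_le (μ := volume) (A := PolyObs)
    (K := metroScan J lam ρ) (w := gibbsWeight J lam)
    (fun φ => (gibbsWeight_pos J lam φ).le) (polyObs_const 1)
    (fun f h hf hh => polyObs_integrable_mul_mul_gibbsWeight one_pos hco hf hh)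
    (fun f h c hf hh => polyObs_add_mul hf hh c)
    (fun f hf => polyObs_metroScan J lam hρ0 hρm hρmom hf)
    (fun f h c hf hh x => metroScan_add_mul_poly J lam hρ0 hρm hρmom hf hh c x)
    (fun f h hf hh => metroScan_reversible_poly one_pos hco hρ0 hρm hρi hρ1 hρs hρmom hf hh)
    (fun f hf => metroScan_contraction_poly one_pos hco hρ0 hρm hρi hρ1 hρs hρmom hf)
    (fun φ => metroScan_one J lam hρ1 φ) hg (polyObs_sq hg) hΓ (show 0 < n + 1 by omega) hs hρV
  have hZ : gibbsZ J lam ≠ 0 := (gibbsZ_pos hlam J).ne'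
  exact (energy_floor_transfer hZ n _).le.trans hfloor

/-- **THE ENERGY FLOOR FOR THE ACTION ITSELF.**  Every `λ > 0`, every real `J`, every even step
density with all moments (window, Gaussian, …); `g = S − ⟨S⟩`: summable sweep-thinned series and
`ρ_g(n+1) < 1` ⇒ `τ_int,sweep(S) ≥ (e²/4) Var(S)/(n+1) − ½`. -/
theorem metropolisScan_tauInt_sweep_ge_actionSelf {lam : ℝ} (hlam : 0 < lam)
    (J : Fin (n + 1) → Fin (n + 1) → ℝ) {ρ : ℝ → ℝ} (hρ0 : ∀ u, 0 ≤ ρ u) (hρm : Measurable ρ)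
    (hρi : Integrable ρ) (hρ1 : ∫ u, ρ u = 1) (hρs : ∀ u, ρ (-u) = ρ u)
    (hρmom : ∀ j : ℕ, Integrable (fun u => (1 + |u|) ^ j * ρ u))
    (hs : Summable fun k => (∫ φ, (latticePhi4Action J lam φ - gibbsExpect J lam (latticePhi4Action J lam))
        * ((metroScan J lam ρ)^[(n + 1) * (k + 1)]
            (fun ψ => latticePhi4Action J lam ψ - gibbsExpect J lam (latticePhi4Action J lam))) φ
        * gibbsWeight J lam φ)
        / ∫ φ, (latticePhi4Action J lam φ - gibbsExpect J lam (latticePhi4Action J lam)) ^ 2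
          * gibbsWeight J lam φ)
    (hρV : (∫ φ, (latticePhi4Action J lam φ - gibbsExpect J lam (latticePhi4Action J lam))
        * ((metroScan J lam ρ)^[n + 1]
            (fun ψ => latticePhi4Action J lam ψ - gibbsExpect J lam (latticePhi4Action J lam))) φ
        * gibbsWeight J lam φ)
        / (∫ φ, (latticePhi4Action J lam φ - gibbsExpect J lam (latticePhi4Action J lam)) ^ 2
          * gibbsWeight J lam φ) < 1) :
    Real.exp 2 / 4 * gibbsExpect J lam (fun φ =>
        (latticePhi4Action J lam φ - gibbsExpect J lam (latticePhi4Action J lam)) ^ 2) / (n + 1) - 1 / 2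
      ≤ tauInt (fun k => (∫ φ, (latticePhi4Action J lam φ - gibbsExpect J lam (latticePhi4Action J lam))
        * ((metroScan J lam ρ)^[(n + 1) * k]
            (fun ψ => latticePhi4Action J lam ψ - gibbsExpect J lam (latticePhi4Action J lam))) φ
        * gibbsWeight J lam φ)
        / ∫ φ, (latticePhi4Action J lam φ - gibbsExpect J lam (latticePhi4Action J lam)) ^ 2
          * gibbsWeight J lam φ) :=
  metropolisScan_tauInt_sweep_ge_energy_poly hlam J hρ0 hρm hρi hρ1 hρs hρmom (polyObs_action J lam)
    (fun _ _ _ => le_rfl) hs hρV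

/-- **THE WINDOW INSTANCE** (the engine's proposal `U[−δ, δ]`, or any even density vanishing outside
`[−δ, δ]`): `τ_int,sweep(S) ≥ (e²/4) Var(S)/(n+1) − ½` for the action itself. -/
theorem metropolisScan_tauInt_sweep_ge_actionSelf_window {lam : ℝ} (hlam : 0 < lam)
    (J : Fin (n + 1) → Fin (n + 1) → ℝ) {ρ : ℝ → ℝ} (hρ0 : ∀ u, 0 ≤ ρ u) (hρm : Measurable ρ)
    (hρi : Integrable ρ) (hρ1 : ∫ u, ρ u = 1) (hρs : ∀ u, ρ (-u) = ρ u) {δ : ℝ}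
    (hρδ : ∀ u, δ < |u| → ρ u = 0)
    (hs : Summable fun k => (∫ φ, (latticePhi4Action J lam φ - gibbsExpect J lam (latticePhi4Action J lam))
        * ((metroScan J lam ρ)^[(n + 1) * (k + 1)]
            (fun ψ => latticePhi4Action J lam ψ - gibbsExpect J lam (latticePhi4Action J lam))) φ
        * gibbsWeight J lam φ)
        / ∫ φ, (latticePhi4Action J lam φ - gibbsExpect J lam (latticePhi4Action J lam)) ^ 2
          * gibbsWeight J lam φ)
    (hρV : (∫ φ, (latticePhi4Action J lam φ - gibbsExpect J lam (latticePhi4Action J lam))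
        * ((metroScan J lam ρ)^[n + 1]
            (fun ψ => latticePhi4Action J lam ψ - gibbsExpect J lam (latticePhi4Action J lam))) φ
        * gibbsWeight J lam φ)
        / (∫ φ, (latticePhi4Action J lam φ - gibbsExpect J lam (latticePhi4Action J lam)) ^ 2
          * gibbsWeight J lam φ) < 1) :
    Real.exp 2 / 4 * gibbsExpect J lam (fun φ =>
        (latticePhi4Action J lam φ - gibbsExpect J lam (latticePhi4Action J lam)) ^ 2) / (n + 1) - 1 / 2
      ≤ tauInt (fun k => (∫ φ, (latticePhi4Action J lam φ - gibbsExpect J lam (latticePhi4Action J lam))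
        * ((metroScan J lam ρ)^[(n + 1) * k]
            (fun ψ => latticePhi4Action J lam ψ - gibbsExpect J lam (latticePhi4Action J lam))) φ
        * gibbsWeight J lam φ)
        / ∫ φ, (latticePhi4Action J lam φ - gibbsExpect J lam (latticePhi4Action J lam)) ^ 2
          * gibbsWeight J lam φ) :=
  metropolisScan_tauInt_sweep_ge_actionSelf hlam J hρ0 hρm hρi hρ1 hρs
    (window_moments hρ0 hρm hρi hρδ) hs hρV

end ActionSelf

end Summit.Ventures.LatticeQCDFlow.Exactness
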